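import Summits.Langlands.Langlands.Theses.ParityBlindBianchi

/-!
BC3 birth skeleton — child `PairCompatibilityAll` of `ParityBlindBianchi.EvenArtinJunction` (stmt-Langlands-2908),
crux-strategist planner-cstrat-stmt-Langlands-2908-r1-0, 2026-08-17.  Exactly 2 named stubs (the ONLY sorries) and
`PairCompatibilityAll_of : stub₁ → stub₂ → PairCompatibilityAll` kernel-checked.  Context = the route file's (the child is restated from Sketch.lean;
after `route edit --split` installs the child decl, delete the `def` below and re-run `ledger skeleton check`).
Stubs: C₁ places away from ℓ (Grothendieck–Deligne WD); C₂ places above ℓ (Fontaine's pinned D_pst); the 10368 LGC stubs re-typed ∀ Rec.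
-/

set_option linter.dupNamespace false

namespace Summit.Langlands.Langlands.Theses.ParityBlindBianchi

open scoped BigOperators Topology Manifold Classical MeasureTheory ProbabilityTheory Matrix InnerProductSpace ComplexConjugate ContinuousMap
open Filter Set Function TopologicalSpace MeasureTheory

/-- C∀ — local–global compatibility for irreducible pinned-geometric a.e.-compatible pairs, all data. -/
def PairCompatibilityAll : Prop :=
  ∀ (K : Type) [Field K] [NumberField K] (Rec : ReciprocityData K) (n : ℕ) (hcpt : Literature.NumberTheory.Automorphic.isCompact_glFiniteIntegralLevel n K), 0 < n → ∀ (π : Literature.NumberTheory.Automorphic.CuspidalAutomorphicRepData n K hcpt), π.1.IsLAlgebraic → ∀ (ℓ : ℕ) [Fact ℓ.Prime] (ι : PadicAlgCl ℓ ≃+* ℂ) (ρ : Literature.NumberTheory.GaloisRepresentations.FramedGaloisRep K (PadicAlgCl ℓ) n), ρ.toGaloisRep.IsIrreducible → ((∀ᶠ v : IsDedekindDomain.HeightOneSpectrum (NumberField.RingOfIntegers K) in cofinite, ρ.IsUnramifiedAt v) ∧ ∀ (v : IsDedekindDomain.HeightOneSpectrum (NumberField.RingOfIntegers K)) (hv :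 ((ℓ : ℕ) : NumberField.RingOfIntegers K) ∈ v.asIdeal), (Literature.NumberTheory.PAdicHodge.fontainePstAdicCompletion v ℓ hv).IsDeRhamFramed (ρ.toLocal v)) → (∀ᶠ v : IsDedekindDomain.HeightOneSpectrum (NumberField.RingOfIntegers K) in cofinite, SatakeFrobCompatibleAt ι π.1 ρ v) → ∀ v : IsDedekindDomain.HeightOneSpectrum (NumberField.RingOfIntegers K), LocalGlobalCompatibleAt Rec ι π.1 ρ v

namespace Cruxes.PairCompatibilityAll.Birth

/-- **stub C₁ (OPEN in general: local–global compatibility AWAY from `ℓ`, all reciprocity data)** — at `v ∤ ℓ`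
the Weil–Deligne representation of `ρ|_{Γ_{K_v}}` (Grothendieck–Deligne) transported along `ι` has
Frobenius-semisimple class `rec_v(π_v)` for EVERY Henniart-normalised datum `Rec`.  Known for regular algebraic
conjugate self-dual `π` over CM fields (Taylor–Yoshida, Shin, Caraiani 2012) and up to monodromy in the HLTT/Scholze
regime (Varma 2024); open for irregular `π`, general `K`, and for the monodromy operator in general.
[cite: TaylorGaloisRepresentations2004, Conj. 7] [cite: HarrisTaylorAMS2001, Thm. A] -/
theorem stub_pairCompatibilityAway :
    ∀ (K : Type) [Field K] [NumberField K] (Rec : ReciprocityData K) (n : ℕ) (hcpt : Literature.NumberTheory.Automorphic.isCompact_glFiniteIntegralLevel n K), 0 < n → ∀ (π : Literature.NumberTheory.Automorphic.CuspidalAutomorphicRepData n K hcpt), π.1.IsLAlgebraic → ∀ (ℓ : ℕ) [Fact ℓ.Prime] (ι : PadicAlgCl ℓ ≃+* ℂ) (ρ : Literature.NumberTheory.GaloisRepresentations.FramedGaloisRep K (PadicAlgCl ℓ) n), ρ.toGaloisRep.IsIrreducible → ((∀ᶠ v : IsDedekindDomain.HeightOneSpectrum (NumberField.RingOfIntegers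 K) in cofinite, ρ.IsUnramifiedAt v) ∧ ∀ (v : IsDedekindDomain.HeightOneSpectrum (NumberField.RingOfIntegers K)) (hv : ((ℓ : ℕ) : NumberField.RingOfIntegers K) ∈ v.asIdeal), (Literature.NumberTheory.PAdicHodge.fontainePstAdicCompletion v ℓ hv).IsDeRhamFramed (ρ.toLocal v)) → (∀ᶠ v : IsDedekindDomain.HeightOneSpectrum (NumberField.RingOfIntegers K) in cofinite, SatakeFrobCompatibleAt ι π.1 ρ v) → ∀ v : IsDedekindDomain.HeightOneSpectrum (NumberField.RingOfIntegers K), ((ℓ : ℕ) : NumberField.RingOfIntegers K) ∉ v.asIdeal → LocalGlobalCompatibleAt Rec ι π.1 ρ v := by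
  sorry

/-- **stub C₂ (OPEN, and formally BLOCKED until D1/D2 of `FontaineDpst` land: local–global compatibility ABOVE `ℓ`)** —
at `v ∣ ℓ` the Weil–Deligne representation `WD(D_pst(ρ|_{Γ_{K_v}}))` of Fontaine's PINNED datum, transported along
`ι`, has class `rec_v(π_v)`.  Known for regular algebraic polarisable `π` over CM fields (Barnet-Lamb–Gee–Geraghty–
Taylor, Caraiani 2014; A'Campo 2024 in the Scholze regime up to semisimplification); open otherwise; in the present
tree the clause refers to the `ε`-pinned Fontaine datum (disprover p105788: undecidable until the construction lands).
[cite: TaylorGaloisRepresentations2004, Conj. 7] [cite: FontaineAsterisque223VIII, §2.3.7] -/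
theorem stub_pairCompatibilityAbove :
    ∀ (K : Type) [Field K] [NumberField K] (Rec : ReciprocityData K) (n : ℕ) (hcpt : Literature.NumberTheory.Automorphic.isCompact_glFiniteIntegralLevel n K), 0 < n → ∀ (π : Literature.NumberTheory.Automorphic.CuspidalAutomorphicRepData n K hcpt), π.1.IsLAlgebraic → ∀ (ℓ : ℕ) [Fact ℓ.Prime] (ι : PadicAlgCl ℓ ≃+* ℂ) (ρ : Literature.NumberTheory.GaloisRepresentations.FramedGaloisRep K (PadicAlgCl ℓ) n), ρ.toGaloisRep.IsIrreducible → ((∀ᶠ v : IsDedekindDomain.HeightOneSpectrum (NumberField.RingOfIntegers K) in cofinite, ρ.IsUnramifiedAt v) ∧ ∀ (v : IsDedekindDomain.HeightOneSpectrum (NumberField.RingOfIntegers K)) (hv : ((ℓ : ℕ) : NumberField.RingOfIntegers K) ∈ v.asIdeal), (Literature.NumberTheory.PAdicHodge.fontainePstAdicCompletion v ℓ hv).IsDeRhamFramed (ρ.toLocal v)) → (∀ᶠ v : IsDedekindDomain.HeightOneSpectrum (NumberField.RingOfIntegers K) in cofinite, SatakeFrobCompatibleAt ι π.1 ρ v)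 → ∀ v : IsDedekindDomain.HeightOneSpectrum (NumberField.RingOfIntegers K), ((ℓ : ℕ) : NumberField.RingOfIntegers K) ∈ v.asIdeal → LocalGlobalCompatibleAt Rec ι π.1 ρ v := by
  sorry

/-- **C∀ from its two stubs** (case split on `v ∣ ℓ`). -/
theorem PairCompatibilityAll_of :
    (∀ (K : Type) [Field K] [NumberField K] (Rec : ReciprocityData K) (n : ℕ) (hcpt : Literature.NumberTheory.Automorphic.isCompact_glFiniteIntegralLevel n K), 0 < n → ∀ (π : Literature.NumberTheory.Automorphic.CuspidalAutomorphicRepData n K hcpt), π.1.IsLAlgebraic → ∀ (ℓ : ℕ) [Fact ℓ.Prime] (ι : PadicAlgCl ℓ ≃+* ℂ) (ρ : Literature.NumberTheory.GaloisRepresentations.FramedGaloisRep K (PadicAlgCl ℓ) n), ρ.toGaloisRep.IsIrreducible → ((∀ᶠ v : IsDedekindDomain.HeightOneSpectrum (NumberField.RingOfIntegers K) in cofinite, ρ.IsUnramifiedAt v) ∧ ∀ (v : IsDedekindDomain.HeightOneSpectrum (NumberField.RingOfIntegers K)) (hv : ((ℓ : ℕ) : NumberField.RingOfIntegers K) ∈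 v.asIdeal), (Literature.NumberTheory.PAdicHodge.fontainePstAdicCompletion v ℓ hv).IsDeRhamFramed (ρ.toLocal v)) → (∀ᶠ v : IsDedekindDomain.HeightOneSpectrum (NumberField.RingOfIntegers K) in cofinite, SatakeFrobCompatibleAt ι π.1 ρ v) → ∀ v : IsDedekindDomain.HeightOneSpectrum (NumberField.RingOfIntegers K), ((ℓ : ℕ) : NumberField.RingOfIntegers K) ∉ v.asIdeal → LocalGlobalCompatibleAt Rec ι π.1 ρ v) →
    (∀ (K : Type) [Field K] [NumberField K] (Rec : ReciprocityData K) (n : ℕ) (hcpt : Literature.NumberTheory.Automorphic.isCompact_glFiniteIntegralLevel n K), 0 < n → ∀ (π : Literature.NumberTheory.Automorphic.CuspidalAutomorphicRepData n K hcpt), π.1.IsLAlgebraic → ∀ (ℓ : ℕ) [Fact ℓ.Prime] (ι : PadicAlgCl ℓ ≃+* ℂ) (ρ : Literature.NumberTheory.GaloisRepresentations.FramedGaloisRep K (PadicAlgCl ℓ) n), ρ.toGaloisRep.IsIrreducible → ((∀ᶠ v : IsDedekindDomain.HeightOneSpectrum (NumberField.RingOfIntegers K) in cofinite, ρ.IsUnramifiedAt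 v) ∧ ∀ (v : IsDedekindDomain.HeightOneSpectrum (NumberField.RingOfIntegers K)) (hv : ((ℓ : ℕ) : NumberField.RingOfIntegers K) ∈ v.asIdeal), (Literature.NumberTheory.PAdicHodge.fontainePstAdicCompletion v ℓ hv).IsDeRhamFramed (ρ.toLocal v)) → (∀ᶠ v : IsDedekindDomain.HeightOneSpectrum (NumberField.RingOfIntegers K) in cofinite, SatakeFrobCompatibleAt ι π.1 ρ v) → ∀ v : IsDedekindDomain.HeightOneSpectrum (NumberField.RingOfIntegers K), ((ℓ : ℕ) : NumberField.RingOfIntegers K) ∈ v.asIdeal → LocalGlobalCompatibleAt Rec ι π.1 ρ v) →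
    PairCompatibilityAll := by
  intro h1 h2 K _ _ Rec n hcpt hn π hL ℓ _ ι ρ hirr hgeo hρ v
  by_cases hv : ((ℓ : ℕ) : NumberField.RingOfIntegers K) ∈ v.asIdeal
  · exact h2 K Rec n hcpt hn π hL ℓ ι ρ hirr hgeo hρ v hv
  · exact h1 K Rec n hcpt hn π hL ℓ ι ρ hirr hgeo hρ v hv

/-- The composition with the stubs plugged in: `PairCompatibilityAll` modulo exactly {C₁, C₂}. -/
theorem PairCompatibilityAll_of_stubs : PairCompatibilityAll :=
  PairCompatibilityAll_of stub_pairCompatibilityAway stub_pairCompatibilityAbove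

end Cruxes.PairCompatibilityAll.Birth

end Summit.Langlands.Langlands.Theses.ParityBlindBianchi
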